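import Summits.CriticalPhenomena.PercolationContinuityZ3.Theses.PercShatteringRace
import Summits.CriticalPhenomena.PercolationContinuityZ3.Theses.PercAnnulusCrossing
import Summits.CriticalPhenomena.PercolationContinuityZ3.Theses.PercFiniteBoxLRO
import Summits.CriticalPhenomena.PercolationContinuityZ3.Theorems.PercShatteringRaceNearLinearTwoClusterDecayOfShellNonCertainty
import Summits.CriticalPhenomena.PercolationContinuityZ3.Theorems.PercShatteringRaceNearLinearTwoClusterDecayOfSparseShellNonCertainty
import Summits.CriticalPhenomena.PercolationContinuityZ3.Theorems.PercShatteringRaceNearLinearTwoClusterDecayOfTICMClosed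
import HarnessLib.Audit

/-!
# Line `critical-orange-peeling` — crux `NearLinearTwoClusterDecay` (stmt-CriticalPhenomena-5785), route `PercShatteringRace`

Lead revision 5 (seat c2, prover-line-stmt-CriticalPhenomena-5785-c2-0, 2026-08-16; re-seated on the line after
lead-0 ended `promote-stub`).  History: rev 1 = the planner's three stubs re-spelled inline; rev 2 = stubs 1–2
LANDED (`stub_peelInclusion` p85433, `stub_shellIndependence` p85476) and the whole composition LANDED as honest
theorems (`Theorems/PercShatteringRaceNearLinearTwoClusterDecayOfShellNonCertainty.lean`, p87166:
`nearLinearTwoClusterDecay_of_shellNonCertainty`, `critBoxTwoArmsDecay_of_shellNonCertainty`,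
`nearLinearTwoClusterDecay_of_critAnnulusNonCrossing`, …); rev 3 = the single remaining stub WEAKENED to the
weakest per-skin input the peel product can use — the POLYLOG-SPARSE window form (defect `c/(log N)^σ`,
`0 ≤ σ < 1`, on one skin of every window of `L` consecutive skins), whose sufficiency is LANDED too
(`Theorems/…OfSparseShellNonCertainty.lean`, p90414); rev 4/5 (this file) = rev 3 + the certified bridge from
the sibling line's atom `TICM_M` (`Theorems.shellNonCertainty_of_ticm`, p98288: two independent critical
crossings of a long shell meet ⇒ clean `NP_M` ⇒ this stub), so that THIS skeleton is the hub every
certified-sufficient per-shell input feeds (clean `NP_M`, constant window, `TICM_M`,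
`PercAnnulusCrossing.CritAnnulusNonCrossing`; `Tight_M ∧ KissPos ∧ BoundedFibre` of line
`shell-product-kiss-positivity` reaches the crux through `Theorems.nearLinearTwoClusterDecay_of_tight_kiss`,
p120440), plus the seat-c2 STRUCTURE PROGRAMME recorded in § Structure below (the crux's load-bearing
hypotheses, monotonicity in the aspect exponent, the BK square, the subcritical analogue, and the print
boundary vdBvE 2022 Prop. 2 — landed file by file under `Theorems/NearLinearTwoClusterDecay/Negative/`,
registered on the item with `workitem stub-add`; they are theorems ABOUT the crux, not hypotheses of
`NearLinearTwoClusterDecay_of`, which still concludes the crux from the ONE open stub).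

Crux (verbatim shape): `Tendsto (fun n ↦ P_{p_c}{ω | ∃ x x' ∈ Λ(n), ∃ y y' ∈ ∂ⁱⁿΛ(m), x ↔ y in Λ(m),
x' ↔ y' in Λ(m), ¬ x ↔ x' in Λ(m)}) atTop (𝓝 0)`, `m = ⌈n^{7/6}⌉₊`, bond percolation on `ℤ³` at `p_c`.

LINE: CRITICAL ORANGE-PEELING (Grimmett 1999 Lemma (7.89) at `p = p_c`, geometric skins):
`P(A₂(n, m')) ≤ P(A₂(n, m)) · P(Sh(m, m'))` for `n ≤ m < m'` (LANDED: `real_twoCluster_peel`), hence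
along the chain `M^k n` the aspect `n^{1/6}` buys `≍ log n` independent skins, and a defect
`1 - P(Sh) ≥ c/(log N)^σ`, `σ < 1`, on one skin per window already forces `P(A₂(n, ⌈n^α⌉)) → 0` for
every `α > 1` (LANDED).  The whole `d = 3` content is the registered stub below (OPEN: bounded-aspect
shell two-cluster non-certainty at `p_c`; false for `d ≥ 7`, barrier `SpanningClustersAboveSix`;
no `d < 6` counting tool is known; numerically `P(N ≤ 1) ≈ 0.45` at `M = 8`, `≈ 0.75` at `M = 16`).

Registered stub (inline spelling; `Statement.stub_shellNonCertainty` is the same Prop in local words):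
* `stub_shellNonCertainty` (XL / OPEN) — `∃ M ≥ 2, ∃ σ ∈ [0,1), ∃ c > 0, ∃ L, ∀ᶠ N, ∃ ℓ < L,
  P_{p_c}(Sh(M^ℓ N, M^{ℓ+1} N)) ≤ 1 - c/(log N)^σ`.
* `NearLinearTwoClusterDecay_of` — the crux BY NAME from the stub (one line into the landed theorem);
  `CritBoxTwoArmsDecay_of` — stmt-0859 likewise; bridges `stub_of_window` (constant defect, `σ = 0`),
  `stub_of_fixedAspect` (clean `NP_M`, `L = 1`), `stub_of_critAnnulusNonCrossing` (stmt-0846), `stub_of_ticm`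
  (`∃ M ≥ 2, TICM_M`, the atom of line `first-cluster-exploration-independent-crossings-meet`).

Disproof.lean (cdisprove v6, RESISTS) honoured: arms consumed by the landed peel; per-skin input
multiplicative (`M ≥ 2`); `K → ∞` uses `m/n = n^{α-1} → ∞`; no crossing-decay/BK road; the stub asks
non-certainty (`≤ 1 - c/(log N)^σ`), never decay, consistent with near-miss (e) (vdBvE Prop. 2).
-/

noncomputable section

open MeasureTheory Filter
open scoped Topology BigOperators
open Literature.Probability.Percolation Literature.Probability.LatticeModels

namespace Summit.CriticalPhenomena.PercolationContinuityZ3.Cruxes.NearLinearTwoClusterDecay.CriticalOrangePeeling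

/-! ## Vocabulary -/

/-- The critical bond-percolation measure `P_{p_c}` on `ℤ³`. [folklore] -/
abbrev Pc : Measure (BondConfig (Site 3)) := bondPercolation (zdGraph 3) (criticalProbI 3)

/-- `A₂(n, m)`: two sites of `Λ(n)`, each joined inside `Λ(m)` to `∂ⁱⁿΛ(m)`, not joined to each
other inside `Λ(m)` (the crux is the instance `m = ⌈n^{7/6}⌉₊`, `crux_iff`). [folklore] -/
def twoClusterBox (n m : ℕ) : Set (BondConfig (Site 3)) :=
  {ω | ∃ x ∈ box 3 n, ∃ x' ∈ box 3 n, ∃ y ∈ innerBoundary (zdGraph 3) (box 3 m),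
    ∃ y' ∈ innerBoundary (zdGraph 3) (box 3 m),
      ω ∈ openConnIn (↑(box 3 m) : Set (Site 3)) x y ∧
      ω ∈ openConnIn (↑(box 3 m) : Set (Site 3)) x' y' ∧
      ω ∉ openConnIn (↑(box 3 m) : Set (Site 3)) x x'}

/-- `Sh(R, R')`: the configuration RESTRICTED TO THE SHELL `Λ(R') ∖ Λ(R)` has two shell-distinct open
clusters, each joining the inner layer `Λ(R+1) ∖ Λ(R)` to `∂ⁱⁿΛ(R')`. [folklore] -/
def shellTwoCluster (R R' : ℕ) : Set (BondConfig (Site 3)) :=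
  {ω | ∃ u ∈ (↑(box 3 (R + 1)) : Set (Site 3)) \ ↑(box 3 R),
    ∃ u' ∈ (↑(box 3 (R + 1)) : Set (Site 3)) \ ↑(box 3 R),
    ∃ v ∈ innerBoundary (zdGraph 3) (box 3 R'), ∃ v' ∈ innerBoundary (zdGraph 3) (box 3 R'),
      ω ∈ openConnIn ((↑(box 3 R') : Set (Site 3)) \ ↑(box 3 R)) u v ∧
      ω ∈ openConnIn ((↑(box 3 R') : Set (Site 3)) \ ↑(box 3 R)) u' v' ∧
      ω ∉ openConnIn ((↑(box 3 R') : Set (Site 3)) \ ↑(box 3 R)) u u'}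

/-- Read-back: the crux is literally `P_{p_c}(A₂(n, ⌈n^{7/6}⌉₊)) → 0` in this vocabulary. [folklore] -/
theorem crux_iff :
    Summit.CriticalPhenomena.PercolationContinuityZ3.Theses.PercShatteringRace.NearLinearTwoClusterDecay ↔
      Tendsto (fun n : ℕ => Pc.real (twoClusterBox n ⌈(n : ℝ) ^ ((7 : ℝ) / 6)⌉₊)) atTop (𝓝 0) :=
  Iff.rfl

/-! ## The stub statement (local vocabulary) -/

namespace Statement

/-- **The stub (HARDEST, XL / open) — bounded-aspect shell two-cluster NON-CERTAINTY at `p_c`,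
polylog-sparse window form** (the weakest per-skin input the orange-peeling product can use):
`∃ M ≥ 2, ∃ σ ∈ [0,1), ∃ c > 0, ∃ L, ∀ᶠ N, ∃ ℓ < L, P_{p_c}(Sh(M^ℓ N, M^{ℓ+1} N)) ≤ 1 - c/(log N)^σ`.
Stronger forms that imply it (bridges below): constant defect (`σ = 0`, = rev-2 stub), clean
`NP_M` (`L = 1`: `∀ᶠ N, P(Sh(N, M N)) ≤ 1 - ε`), `PercAnnulusCrossing.CritAnnulusNonCrossing`.
It is the ENTIRE `d < 6` content of the line (false for `d ≥ 7`).
[cite: arXiv:2009.13337, Prop. 2 and Lemma 6 (the complementary lower pin at bounded aspect)] -/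
def stub_shellNonCertainty : Prop :=
  ∃ M : ℕ, 2 ≤ M ∧ ∃ σ : ℝ, 0 ≤ σ ∧ σ < 1 ∧ ∃ c : ℝ, 0 < c ∧ ∃ L : ℕ, ∀ᶠ N : ℕ in atTop, ∃ ℓ < L,
    Pc.real (shellTwoCluster (M ^ ℓ * N) (M ^ (ℓ + 1) * N)) ≤ 1 - c / Real.log N ^ σ

end Statement

/-! ## The registered stub (the only open goal of the line) — INLINE spelling over tree declarations -/

/-- THE stub (XL/open): bounded-aspect shell two-cluster non-certainty at `p_c`, polylog-sparse window
form, inline spelling (`= Statement.stub_shellNonCertainty` by `Iff.rfl`). [cite: arXiv:2009.13337, Prop. 2] -/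
theorem stub_shellNonCertainty :
    ∃ M : ℕ, 2 ≤ M ∧ ∃ σ : ℝ, 0 ≤ σ ∧ σ < 1 ∧ ∃ c : ℝ, 0 < c ∧ ∃ L : ℕ,
      ∀ᶠ N : ℕ in atTop, ∃ ℓ < L,
      (bondPercolation (zdGraph 3) (criticalProbI 3)).real
          {ω | ∃ u ∈ (↑(box 3 (M ^ ℓ * N + 1)) : Set (Site 3)) \ ↑(box 3 (M ^ ℓ * N)),
            ∃ u' ∈ (↑(box 3 (M ^ ℓ * N + 1)) : Set (Site 3)) \ ↑(box 3 (M ^ ℓ * N)),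
            ∃ v ∈ innerBoundary (zdGraph 3) (box 3 (M ^ (ℓ + 1) * N)),
            ∃ v' ∈ innerBoundary (zdGraph 3) (box 3 (M ^ (ℓ + 1) * N)),
              ω ∈ openConnIn ((↑(box 3 (M ^ (ℓ + 1) * N)) : Set (Site 3)) \ ↑(box 3 (M ^ ℓ * N))) u v ∧
              ω ∈ openConnIn ((↑(box 3 (M ^ (ℓ + 1) * N)) : Set (Site 3)) \ ↑(box 3 (M ^ ℓ * N))) u' v' ∧
              ω ∉ openConnIn ((↑(box 3 (M ^ (ℓ + 1) * N)) : Set (Site 3)) \ ↑(box 3 (M ^ ℓ * N))) u u'}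
        ≤ 1 - c / Real.log N ^ σ := by
  sorry

/-- The inline spelling IS the `Statement` Prop. [folklore] -/
theorem stub_shellNonCertainty_holds : Statement.stub_shellNonCertainty := stub_shellNonCertainty

/-! ## Composition (one line into the LANDED theorems) -/

/-- **`NearLinearTwoClusterDecay_of`** — the crux BY NAME from the single registered stub
(everything else is landed: `Theorems.nearLinearTwoClusterDecay_of_sparseShellNonCertainty`). [folklore] -/
theorem NearLinearTwoClusterDecay_of :
    Statement.stub_shellNonCertainty →
      Summit.CriticalPhenomena.PercolationContinuityZ3.Theses.PercShatteringRace.NearLinearTwoClusterDecay :=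
  fun h => Summit.CriticalPhenomena.PercolationContinuityZ3.Theorems.nearLinearTwoClusterDecay_of_sparseShellNonCertainty h

/-- **The crux modulo the registered stub.** [folklore] -/
theorem NearLinearTwoClusterDecay_skeleton :
    Summit.CriticalPhenomena.PercolationContinuityZ3.Theses.PercShatteringRace.NearLinearTwoClusterDecay :=
  NearLinearTwoClusterDecay_of stub_shellNonCertainty_holds

/-- **Bonus edge (landed)**: the same stub gives `PercFiniteBoxLRO.CritBoxTwoArmsDecay`
(stmt-CriticalPhenomena-0859, `U(b)` for every `b > 0`). [folklore] -/
theorem CritBoxTwoArmsDecay_of :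
    Statement.stub_shellNonCertainty →
      Summit.CriticalPhenomena.PercolationContinuityZ3.Theses.PercFiniteBoxLRO.CritBoxTwoArmsDecay :=
  fun h => Summit.CriticalPhenomena.PercolationContinuityZ3.Theorems.critBoxTwoArmsDecay_of_sparseShellNonCertainty h

/-! ## Bridges: three STRONGER statements, each of which gives the stub (certified) -/

/-- The constant-defect window form (rev-2 stub; `σ = 0`) gives the stub. [folklore] -/
theorem stub_of_window
    (h : ∃ M : ℕ, 2 ≤ M ∧ ∃ ε : ℝ, 0 < ε ∧ ∃ L : ℕ, ∀ᶠ N : ℕ in atTop, ∃ ℓ < L,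
      Pc.real (shellTwoCluster (M ^ ℓ * N) (M ^ (ℓ + 1) * N)) ≤ 1 - ε) :
    Statement.stub_shellNonCertainty := by
  obtain ⟨M, hM, ε, hε, L, hev⟩ := h
  refine ⟨M, hM, 0, le_rfl, zero_lt_one, ε, hε, L, ?_⟩
  filter_upwards [hev] with N ⟨ℓ, hℓ, hN⟩
  exact ⟨ℓ, hℓ, by simpa [Real.rpow_zero] using hN⟩

/-- The clean fixed-aspect form `NP_M` (`∃ M ≥ 2, ε > 0, ∀ᶠ N, P_{p_c}(Sh(N, M N)) ≤ 1 - ε`) gives the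
stub (`L = 1`, `σ = 0`). [folklore] -/
theorem stub_of_fixedAspect
    (h : ∃ M : ℕ, 2 ≤ M ∧ ∃ ε : ℝ, 0 < ε ∧ ∀ᶠ N : ℕ in atTop,
      Pc.real (shellTwoCluster N (M * N)) ≤ 1 - ε) :
    Statement.stub_shellNonCertainty := by
  obtain ⟨M, hM, ε, hε, hev⟩ := h
  refine stub_of_window ⟨M, hM, ε, hε, 1, ?_⟩
  filter_upwards [hev] with N hN
  exact ⟨0, Nat.one_pos, by simpa using hN⟩

/-- `PercAnnulusCrossing.CritAnnulusNonCrossing` (stmt-CriticalPhenomena-0846) gives the stub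
(`M = 3`, landed `Theorems.shellNonCertainty_of_critAnnulusNonCrossing`). Bookkeeping: `X_B` is
summit-strength. [folklore] -/
theorem stub_of_critAnnulusNonCrossing
    (hXB : Summit.CriticalPhenomena.PercolationContinuityZ3.Theses.PercAnnulusCrossing.CritAnnulusNonCrossing) :
    Statement.stub_shellNonCertainty :=
  stub_of_window (Summit.CriticalPhenomena.PercolationContinuityZ3.Theorems.shellNonCertainty_of_critAnnulusNonCrossing hXB)


/-- The sibling line's atom `∃ M ≥ 2, TICM_M` ("two INDEPENDENT critical crossings of the shell
`Λ(MN) ∖ Λ(N)` meet: the second copy cannot avoid the first crossing cluster with probability `≥ c`")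
gives the stub, through the landed `Theorems.shellNonCertainty_of_ticm` (p98288, clean `NP_M`) and
`stub_of_fixedAspect`. [folklore] -/
theorem stub_of_ticm
    (hT : ∃ M : ℕ, 2 ≤ M ∧ ∃ c : ℝ, 0 < c ∧ ∀ᶠ N : ℕ in atTop,
      ∫⁻ ω, bondPercolation (zdGraph 3) (criticalProbI 3)
          {ω' : BondConfig (Site 3) |
            ∃ u ∈ (↑(box 3 (N + 1)) : Set (Site 3)) \ ↑(box 3 N),
            ∃ v ∈ innerBoundary (zdGraph 3) (box 3 (M * N)),
              ω ∈ openConnIn ((↑(box 3 (M * N)) : Set (Site 3)) \ ↑(box 3 N)) u v ∧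
              ∃ u' ∈ (↑(box 3 (N + 1)) : Set (Site 3)) \ ↑(box 3 N),
              ∃ v' ∈ innerBoundary (zdGraph 3) (box 3 (M * N)),
                ω' ∈ openConnIn ((((↑(box 3 (M * N)) : Set (Site 3)) \ ↑(box 3 N))) ∩
                  {w : Site 3 | ω ∉ openConnIn ((↑(box 3 (M * N)) : Set (Site 3)) \ ↑(box 3 N)) u w})
                  u' v'}
        ∂(bondPercolation (zdGraph 3) (criticalProbI 3)) ≤ ENNReal.ofReal (1 - c)) :
    Statement.stub_shellNonCertainty :=
  stub_of_fixedAspect (Summit.CriticalPhenomena.PercolationContinuityZ3.Theorems.shellNonCertainty_of_ticm hT)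

/-! ## Structure of the crux (seat c2 programme; theorems ABOUT the crux, LANDED under
`Theorems/NearLinearTwoClusterDecay/Negative/`, namespace `…Theorems.NearLinearTwoClusterDecay.Negative`,
registered on the item; proved from the standing disprover's `Disproof.lean` v6 and from tree tools)

* `LoadBearing.lean` (p121536) — `not_atExponent_of_le_one`, `nearLinearTwoClusterDecay_false_at_aspect_one`
  (any proof uses `α > 1`), `nearLinearTwoClusterDecay_false_without_arms` (the two arms cannot be dropped).
* `Rays.lean` (p123988) — `real_twoClusterEvt_pos`, `not_eventually_real_eq_zero` (non-null at every scale),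
  `not_tendsto_additive_aspect` / `nearLinearTwoClusterDecay_false_additive_aspect` (any proof uses `m - n → ∞`).
* `Structure.lean` (p123999) — `percolationContinuityZ3_of_crossingDecay` / `…_of_crossing_tendsto_zero`
  (the monotone/BK road proves `θ(p_c) = 0` outright), `real_twoClusterEvt_le_sq` / `real_twoCluster_le_crossing_sq`
  (BK square), `real_twoClusterEvt_antitone`, `atExponent_mono` / `twoCluster_tendsto_zero_mono`
  (`U(1/6) ⇒ U(b)` for all `b ≥ 1/6`; decay at any `α ∈ [1, 7/6]` gives the crux),
  `subcritical_twoCluster_decay` (the crux statement is TRUE for every `p < p_c`).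
* THE PRINT BOUNDARY (van den Berg–van Engelenburg 2022, arXiv:2009.13337 Lemma 6 / Prop. 2, bond version
  on `ℤ³`), bricks: `AspectRenorm.lean` (p122418, `aspectCrossing_renorm`), `AspectCrossingPos.lean` (p124083,
  `critAspectCrossing_pos`: critical crossing positivity at EVERY bounded aspect), `GluedCriterion.lean`
  (p122910, `gluedCriterion`: same-`p` finite-size criterion with uniqueness gluing), `Dichotomy.lean`
  (p124197, `critTwoCluster_dichotomy`: `ε(M) ≤ P_{p_c}(Λ(n) ↮ ∂ⁱⁿΛ(16Mn)) + P_{p_c}(A₂(4n,4Mn))` at EVERY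
  scale), `CrossingCertainJ.lean` (p122985), `SlabTiling.lean` (p123241), `FaceDecomposition.lean` (p123456),
  `FaceSymmetry.lean` (p123758), `PlateCrossing.lean` (p123929), `BoundedAspectGeometry.lean` (p124344,
  `twoCluster_ge_barrier_mul_plate_sq`: `E₁ ∩ F₂ ∩ F₃ ⊆ A₂`, independence, reflection); conclusions:
  `BoundedAspectJ.lean` — `twoCluster_boundedAspect_of_theta_pos`: in ANY `θ(p_c) > 0` world (the only world
  in which the route consumes `U`) `P_{p_c}(A₂(4n,4Mn)) ≥ ε(M)/2` for all large `n`, every `M`;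
  `BoundedAspect.lean` — `not_tendsto_twoCluster_boundedAspect`: **for every `M ≥ 2`,
  `P_{p_c}(A₂(n, Mn)) ↛ 0`** (bounded multiplicative aspect is FALSE; `b > 0` is essential; the disprover's
  only `sorry` discharged), `twoCluster_boundedAspect_frequently`, `twoCluster_boundedAspect_pos`.
-/

end Summit.CriticalPhenomena.PercolationContinuityZ3.Cruxes.NearLinearTwoClusterDecay.CriticalOrangePeeling

end
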